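import Summits.QuantumFields.YangMills.Theorems.UnitScaleTiltProp7NestedMeanPoincare
import Summits.QuantumFields.YangMills.Theorems.UnitScaleTiltProp7QTwSCentralTowerRows
import Literature.MathematicalPhysics.QuantumFieldTheory.Balaban1983to89.B15DeterminingSets
import HarnessLib

/-!
# Route `UnitScaleTilt`, crux K1 child «MinimiserStabilityRegPr» (stmt-QuantumFields-19200), skeleton v10, stub `stub_existenceMinimalOrbit` (EX), route (α) —
# **(ROW-R2q″, FILE 2) THE BLOCK BUMP EXTENSION `S c = χ·Ad(frame)c(block)` AND ITS η-FREE H⁰∕H¹ ROWS** — step (b) of ★w5-20520 g7's (P2-core) plan v2 (memo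
# `pub/ym3-torus/ym-ust-20520-w5/g7/LOCATE-P2-MARGIN-w5g7.md` v1.1 §(b)), in the DESIGN OF RECORD of 2026-08-28 19:56Z: the constant `c(Y)` on the top block `Y = B^k(x)` is
# framed by ★px11 g2's corner-axial reference `C k Y x = (axialT U (q Y) (embIter k Y))⁻¹·axialT U (q Y) x` (so that `conjR (C k Y x) (S c x) = χ_Y(x)·c(Y)` EXACTLY — the
# reference mean of ✓`Prop7NestedMeanPoincare.norm_ns_sub_refMean_le` reads `κ·c(Y)`), cut off by a bump `χ_Y` supported inside the block with its neighbours; the H² row is NOT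
# produced here (resolvent smoothing, ✓`Prop7ResolventSmoothing`), so no curvature-gradient input enters (LOCATE `ym3-torus-px10/LOCATE-R2q-px10g2.md` (L3) is moot by design).

Cell `ym3-torus`, width seat `ym3-torus-px10` (gen 2).  THEOREMS ONLY (0 `def`, 0 `sorry`).  `--supports stmt-QuantumFields-19200 --as helper`, count-neutral.  YM₃ on T³ is a
ladder rung (R3), not the Clay problem; nothing here claims the stub, the crux, d = 4 or the mass gap.

WHAT IS PROVED (sorry-free, no definition; ns `…Theorems.Prop7BlockBumpExtension`).
* §1 (generic `P`, `M_N(ℂ)`-units) ★`conjR_framed_sub_framed_eq` — the covariant difference of the framed constant across a bond `b` is, in the frame at `b₋`, the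
  conjugation defect of the GAUGE-TRANSFORMED bond `W b = w(b₋)U(b)w(b₊)⁻¹`, `w = axialT U (q Y)`; ★★`norm_conjR_framed_sub_framed_le` — hence `≤ (2s₀ + lχ)·‖c‖` when
  `‖W b − 1‖ ≤ s₀`, `0 ≤ χ ≤ 1`, `|χ(b₊) − χ(b₋)| ≤ lχ`.
* §2 (generic `P`) `sum_eq_sum_iterBlock`, `sum_comp_iterBlockOf` (`Σ_x F(B^k x) = L^{dk}Σ_Y F(Y)`), `sum_pbond_eq`.
* §3 (T³ member) ★★★`exists_blockBumpExtension` — `S` as a ℂ-LINEAR map with its defining formula and the rows **(H⁰) `‖toL2S (S c)‖² ≤ 2·Q c`**,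
  **(H¹) `‖D_{U₀}(toL2S (S c))‖² ≤ 6·((2s₀ + lχ)∕η)²·Q c`**, `Q c = c₀·η⁻³·Σ_Y Σ_{jk}|c(Y)_{jk}|²` (the coarse ℓ² currency of record), under the DISPLAYED rows: bump range∕support∕Lipschitz
  (`hχ01 hχsh hχun hχlip`) and ★px11 g2's bond row `hax` («every bond of `B^k(Y)` is `s₀`-close to `1` in the block gauge»; his part 2: `s₀ = 2d(L^k−1)·ε₀η² ≤ 6ε₀η` from `RegPr`).
  INHABITABILITY: `χ := 0` satisfies every bump row (then `S = 0`); `U₀ = 1` gives `hax` with `s₀ = 0`; the fat separable bump of the sequel file inhabits the rows with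
  `lχ = η∕w` and mass `κ ≥ (1 − 2w − 2η)³`.
* §4 (v1.1) `normSq_toL2S_comp_siteShift_eq` (`Q c = ‖toL2S F n c₁ (c ∘ siteShift)‖²` at `c₁ = c₀η⁻³`) and ★★★`exists_blockBumpExtension_rows` — the same `S` with (H⁰)∕(H¹) in the
  (P2)-knit's currency `q c := ‖toL2S F n c₁ (c ∘ siteShift)‖`: `≤ √2·q c` and `≤ (√6(2s₀+lχ)∕η)·q c` (the `hS0`∕`hS1` slots of ✓`Prop7ResolventSmoothing.hQ4_of_rows`).
HONEST SCOPE: `s₀^{H⁰} = √2` (operator → Frobenius), not the sharp `1`; the bond count uses all `d = 3` directions at every site of the support's block; nothing of print asserted.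

References: T. Bałaban, CMP 99 (1985) 389–434 [Balaban1985BackgroundPropagators] ((3.3) p.391, (3.11) p.392, (3.114)–(3.115) p.418); CMP 99 (1985) 75–102
[Balaban1985RegularSpaces] (Lemma 1 (1.25) p.79); CMP 98 (1985) 17–51 [Balaban1985Averaging] ((8)–(9) pp.18–19, (18)–(20) p.21); CMP 95 (1984) 17–40 [Balaban1984PropagatorsI]
((1.6) p.18, (1.18) p.20); CMP 109 (1987) 249–301 [Balaban1987RG1] ((0.1) p.251).
-/

set_option autoImplicit false

noncomputable section

open scoped BigOperators Matrix.Norms.L2Operator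

namespace Summit.QuantumFields.YangMills.Theorems.Prop7BlockBumpExtension

open Literature.MathematicalPhysics.QuantumFieldTheory.Balaban1983to89
open T4Continuum T4ReflectionCone BlockAveraging
open B5Eq118OneStroke (iterBlockOf iterBlock mem_iterBlock mem_iterBlock_iff)
open B15DeterminingSets (embIter)

/-! ## §1 The corner-axial framed constant and its covariant-difference stencil (★px11 g2's reference family `C`, top level) -/

section Frame

variable {P : Params} {N : ℕ} [NeZero N] {k : ℕ}

open B7Prop1Explicit (U1 mem_U1)
open B7Eq78Linearization (conjR conjR_apply conjR_sub conjR_smul_real)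
open B8Ineq132 (norm_conjR conjR_conjR one_conjR)
open B10Eq27TorusAxialLog (holT axialT gaugeActT gaugeActT_apply)
open Summit.QuantumFields.YangMills.Theorems.Prop7CovariantCoercivity (norm_conjR_sub_conjR_le)

omit [NeZero N] in
/-- **THE STENCIL IDENTITY.**  With `w := axialT U (q Y)` (the block gauge), `g := w (embIter k Y)`, `W := U^{w}` (`W b = w(b₋)·U(b)·w(b₊)⁻¹`) and the framed constant
`f x := conjR ((g⁻¹·w x)⁻¹) C = conjR (w x)⁻¹ (conjR g C)`: for a bond `b`,
`conjR (U b) (t • f b₊) − s • f b₋ = conjR (w b₋)⁻¹ (t • conjR (W b) (conjR g C) − s • conjR g C)` — the covariant difference of the framed constant across `b` is, in the frame at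
`b₋`, the conjugation defect of the GAUGE-TRANSFORMED bond variable. [cite: Balaban1985Averaging, (8)-(9) pp.18-19; Balaban1985RegularSpaces, (1.25) p.79] -/
theorem conjR_framed_sub_framed_eq (U : GaugeField P 0 (Matrix (Fin N) (Fin N) ℂ)ˣ) (q₀ : Site P 0) (Y : Site P k) (b : PBond P 0) (C : Matrix (Fin N) (Fin N) ℂ) (s t : ℝ) :
    conjR (U b) (t • conjR ((axialT U q₀ (embIter k Y))⁻¹ * axialT U q₀ b.tgt)⁻¹ C) - s • conjR ((axialT U q₀ (embIter k Y))⁻¹ * axialT U q₀ b.src)⁻¹ C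
      = conjR (axialT U q₀ b.src)⁻¹
          (t • conjR (gaugeActT (axialT U q₀) U b) (conjR (axialT U q₀ (embIter k Y)) C) - s • conjR (axialT U q₀ (embIter k Y)) C) := by
  set w := axialT U q₀ with hw
  set g : (Matrix (Fin N) (Fin N) ℂ)ˣ := axialT U q₀ (embIter k Y) with hg
  have hW : gaugeActT w U b = w b.src * U b * (w b.tgt)⁻¹ := gaugeActT_apply _ _ _
  have h1 : U b * ((w b.tgt)⁻¹ * g) = (w b.src)⁻¹ * gaugeActT w U b * g := by rw [hW]; group
  simp only [conjR_sub, conjR_smul_real, mul_inv_rev, inv_inv, conjR_conjR]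
  rw [h1, mul_assoc]

/-- ★★ **THE POINTWISE BOUND ON THE STENCIL**: if `U` is `U1`-valued, the gauge-transformed bond variable is `s₀`-close to `1` (`‖W b − 1‖ ≤ s₀`), `0 ≤ t ≤ 1` and `|t − s| ≤ lχ`, then
`‖conjR (U b) (t • f b₊) − s • f b₋‖ ≤ (2s₀ + lχ)·‖C‖` (`U1` conjugations are isometries ✓`B8Ineq132.norm_conjR`; `‖conjR W D − D‖ ≤ 2‖W − 1‖‖D‖` ✓`norm_conjR_sub_conjR_le`).
[cite: Balaban1985Averaging, (19)-(20) p.21; Balaban1985RegularSpaces, (1.25) p.79] -/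
theorem norm_conjR_framed_sub_framed_le (U : GaugeField P 0 (Matrix (Fin N) (Fin N) ℂ)ˣ) (hU : ∀ b, U b ∈ U1 (Matrix (Fin N) (Fin N) ℂ)) (q₀ : Site P 0) (Y : Site P k)
    (b : PBond P 0) (C : Matrix (Fin N) (Fin N) ℂ) {s t s₀ lχ : ℝ} (ht0 : 0 ≤ t) (ht1 : t ≤ 1) (hts : |t - s| ≤ lχ)
    (hb : ‖((gaugeActT (axialT U q₀) U b : (Matrix (Fin N) (Fin N) ℂ)ˣ) : Matrix (Fin N) (Fin N) ℂ) - 1‖ ≤ s₀) :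
    ‖conjR (U b) (t • conjR ((axialT U q₀ (embIter k Y))⁻¹ * axialT U q₀ b.tgt)⁻¹ C) - s • conjR ((axialT U q₀ (embIter k Y))⁻¹ * axialT U q₀ b.src)⁻¹ C‖
      ≤ (2 * s₀ + lχ) * ‖C‖ := by
  have hw : ∀ x, axialT U q₀ x ∈ U1 (Matrix (Fin N) (Fin N) ℂ) := fun x => Prop7SymAvgTwSym.holT_mem_U1 hU _ _
  have hW : gaugeActT (axialT U q₀) U b ∈ U1 (Matrix (Fin N) (Fin N) ℂ) := by
    rw [gaugeActT_apply]; exact (U1 _).mul_mem ((U1 _).mul_mem (hw _) (hU b)) ((U1 _).inv_mem (hw _))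
  set D := conjR (axialT U q₀ (embIter k Y)) C with hD
  have hDn : ‖D‖ = ‖C‖ := norm_conjR (hw _) C
  rw [conjR_framed_sub_framed_eq, norm_conjR ((U1 _).inv_mem (hw _))]
  have e : t • conjR (gaugeActT (axialT U q₀) U b) D - s • D = t • (conjR (gaugeActT (axialT U q₀) U b) D - conjR 1 D) + (t - s) • D := by
    rw [one_conjR, smul_sub, sub_smul]; abel
  rw [e]
  have h1 : ‖conjR (gaugeActT (axialT U q₀) U b) D - conjR 1 D‖ ≤ 2 * s₀ * ‖C‖ := by
    refine (norm_conjR_sub_conjR_le ((U1 _).one_mem) hW D).trans ?_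
    rw [Units.val_one, hDn]
    exact mul_le_mul_of_nonneg_right (mul_le_mul_of_nonneg_left hb (by norm_num)) (norm_nonneg _)
  calc ‖t • (conjR (gaugeActT (axialT U q₀) U b) D - conjR 1 D) + (t - s) • D‖
      ≤ ‖t • (conjR (gaugeActT (axialT U q₀) U b) D - conjR 1 D)‖ + ‖(t - s) • D‖ := norm_add_le _ _
    _ = |t| * ‖conjR (gaugeActT (axialT U q₀) U b) D - conjR 1 D‖ + |t - s| * ‖C‖ := by rw [norm_smul, norm_smul, Real.norm_eq_abs, Real.norm_eq_abs, hDn]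
    _ ≤ 1 * (2 * s₀ * ‖C‖) + lχ * ‖C‖ := by
        refine add_le_add (mul_le_mul ?_ h1 (norm_nonneg _) zero_le_one) (mul_le_mul_of_nonneg_right hts (norm_nonneg _))
        rw [abs_of_nonneg ht0]; exact ht1
    _ = (2 * s₀ + lχ) * ‖C‖ := by ring

end Frame


/-! ## §2 Sums over the fine torus by top blocks -/

section Sums

variable {P : Params} {k : ℕ}

/-- `B^k(y)` is the fibre of `iterBlockOf k` over `y`. [cite: Balaban1984PropagatorsI, (1.6) p.18] -/
theorem iterBlock_eq_filter (y : Site P k) : iterBlock k y = Finset.univ.filter (fun x : Site P 0 => iterBlockOf k x = y) := by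
  ext x; rw [mem_iterBlock, Finset.mem_filter]; simp

/-- **A SUM OVER THE FINE TORUS IS THE SUM OVER THE TOP BLOCKS OF THE SUMS OVER EACH BLOCK.** [cite: Balaban1984PropagatorsI, (1.6) p.18, (1.18) p.20] -/
theorem sum_eq_sum_iterBlock {M : Type*} [AddCommMonoid M] (f : Site P 0 → M) :
    ∑ x : Site P 0, f x = ∑ y : Site P k, ∑ x ∈ iterBlock k y, f x := by
  rw [← Finset.sum_fiberwise_of_maps_to (s := Finset.univ) (t := Finset.univ) (g := iterBlockOf k) (fun x _ => Finset.mem_univ _) f]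
  exact Finset.sum_congr rfl fun y _ => by rw [iterBlock_eq_filter]

/-- A function of the BLOCK summed over the fine torus: `Σ_x F(B^k x) = L^{dk}·Σ_y F(y)`. [cite: Balaban1984PropagatorsI, (1.18) p.20] -/
theorem sum_comp_iterBlockOf (hk : k ≤ P.m + P.K) (F : Site P k → ℝ) :
    ∑ x : Site P 0, F (iterBlockOf k x) = ((P.L : ℝ) ^ P.d) ^ k * ∑ y : Site P k, F y := by
  rw [sum_eq_sum_iterBlock (k := k), Finset.mul_sum]
  refine Finset.sum_congr rfl fun y _ => ?_
  rw [Finset.sum_congr rfl fun x hx => by rw [(mem_iterBlock k y x).1 hx], Finset.sum_const, B5Eq118OneStroke.card_iterBlock k hk y, nsmul_eq_mul]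
  push_cast; ring

/-- Sums over positively oriented bonds are sums over (source, direction). [folklore] -/
theorem sum_pbond_eq {M : Type*} [AddCommMonoid M] {j : ℕ} (g : PBond P j → M) : ∑ b : PBond P j, g b = ∑ x : Site P j, ∑ μ : Fin P.d, g ⟨x, μ⟩ := by
  rw [← Fintype.sum_prod_type' (f := fun (x : Site P j) (μ : Fin P.d) => g ⟨x, μ⟩)]
  let e : Site P j × Fin P.d ≃ PBond P j := ⟨fun p => ⟨p.1, p.2⟩, fun b => (b.src, b.dir), fun _ => rfl, fun _ => rfl⟩
  exact (Fintype.sum_equiv e (fun p : Site P j × Fin P.d => g ⟨p.1, p.2⟩) g (fun _ => rfl)).symm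

end Sums

/-! ## §3 The T³ member: the extension `S` as a linear map and its η-free H⁰∕H¹ rows -/

section Member

open Literature.MathematicalPhysics.QuantumFieldTheory.Balaban1983to89.T3ContinuumYM3Torus
open T3SectALandauChart (eta eta_pos bgUnits)
open B7Prop1Explicit (U1 mem_U1)
open B7Eq78Linearization (conjR conjR_apply conjR_sub conjR_smul_real)
open B8Ineq132 (norm_conjR conjR_conjR one_conjR)
open B10Eq27TorusAxialLog (holT axialT gaugeActT gaugeActT_apply unitsField toUField)
open Summit.QuantumFields.YangMills.Theorems.Prop7SectET3Transport (bondEquiv bgOfCfg val_bgOfCfg isUnitaryBg_bgOfCfg)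
open Summit.QuantumFields.YangMills.Theorems.Prop7SectET3HilbertLetters (W₂ toL2 toL2S DL2 DL2_apply)
open Summit.QuantumFields.YangMills.Theorems.Prop7NestedMeanPoincare (normSq_toL2S_eq normSq_toL2_eq normSq_toL2S_le_two_mul conjR_unitsField_toUField)
open Summit.QuantumFields.YangMills.Theorems.Prop7CovariantCoercivity (sum_norm_sq_le_mul_opNorm_sq)

variable (F : T3Family) {n K : ℕ}

/-- ★★★ **THE BLOCK BUMP EXTENSION AND ITS η-FREE H⁰∕H¹ ROWS** ((b) of the (P2-core) plan v2, design of record 2026-08-28 19:56Z: bump × constant framed by ★px11's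
corner-axial references).  Data at the member (`k = K − n`, `U = U₀♭`): a base-point map `q` on the top blocks, a bump family `χ` with the displayed rows (range `[0,1]`,
support in the block WITH ITS NEIGHBOURS, Lipschitz constant `lχ` along bonds), and the displayed bond row `hax` («in the block gauge `axialT U (q Y)` every bond of `B^k(Y)` is
`s₀`-close to `1`», ★px11 g2's `hax`, [Balaban1985RegularSpaces] Lemma 1).  Then the ℂ-linear map
**`S c x = χ_{Y}(x) • conjR ((axialT U (q Y) (embIter k Y))⁻¹·axialT U (q Y) x)⁻¹ (c Y)`**, `Y = B^k(x)`, satisfies, with `Q c := c₀·η⁻³·Σ_Y Σ_{jk}|c(Y)_{jk}|²` (the coarse ℓ²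
currency of record): **(H⁰) `‖toL2S (S c)‖² ≤ 2·Q c`** and **(H¹) `‖D_{U₀}(toL2S (S c))‖² ≤ 6·((2s₀ + lχ)∕η)²·Q c`** — both η-free once `s₀ = O(ε₀η)`, `lχ = O(η)`.
[cite: Balaban1985BackgroundPropagators, (3.3) p.391, (3.11) p.392, (3.114)-(3.115) p.418; Balaban1985RegularSpaces, Lemma 1 (1.25) p.79; Balaban1985Averaging, (18)-(20) p.21] -/
theorem exists_blockBumpExtension {c₀ : ℝ} [Fact (0 < c₀)] (U₀ : GaugeField (F.P K) 0 (Matrix.specialUnitaryGroup (Fin 2) ℂ))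
    (q : Site (F.P K) (K - n) → Site (F.P K) 0) (χ : Site (F.P K) (K - n) → Site (F.P K) 0 → ℝ) {s₀ lχ : ℝ} (hs₀ : 0 ≤ s₀) (hlχ : 0 ≤ lχ)
    (hχ01 : ∀ Y x, 0 ≤ χ Y x ∧ χ Y x ≤ 1)
    (hχsh : ∀ Y x μ, χ Y x ≠ 0 → iterBlockOf (K - n) (x.shift μ) = Y) (hχun : ∀ Y x μ, χ Y x ≠ 0 → iterBlockOf (K - n) (x.unshift μ) = Y)
    (hχlip : ∀ Y x μ, |χ Y (x.shift μ) - χ Y x| ≤ lχ)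
    (hax : ∀ (Y : Site (F.P K) (K - n)) (b : PBond (F.P K) 0), iterBlockOf (K - n) b.src = Y → iterBlockOf (K - n) b.tgt = Y →
      ‖((gaugeActT (axialT (bgUnits F K U₀) (q Y)) (bgUnits F K U₀) b : (Matrix (Fin 2) (Fin 2) ℂ)ˣ) : Matrix (Fin 2) (Fin 2) ℂ) - 1‖ ≤ s₀) :
    ∃ S : (Site (F.P K) (K - n) → Matrix (Fin 2) (Fin 2) ℂ) →ₗ[ℂ] (Site (F.P K) 0 → Matrix (Fin 2) (Fin 2) ℂ),
      (∀ c x, S c x = (χ (iterBlockOf (K - n) x) x) •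
        conjR ((axialT (bgUnits F K U₀) (q (iterBlockOf (K - n) x)) (embIter (K - n) (iterBlockOf (K - n) x)))⁻¹ *
          axialT (bgUnits F K U₀) (q (iterBlockOf (K - n) x)) x)⁻¹ (c (iterBlockOf (K - n) x))) ∧
      (∀ c, ‖toL2S F K c₀ (S c)‖ ^ 2 ≤ 2 * (c₀ * (eta F n K)⁻¹ ^ 3 * ∑ Y : Site (F.P K) (K - n), ∑ j : Fin 2, ∑ k : Fin 2, ‖c Y j k‖ ^ 2)) ∧
      (∀ c, ‖DL2 F n K c₀ U₀ (toL2S F K c₀ (S c))‖ ^ 2 ≤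
        6 * ((2 * s₀ + lχ) / eta F n K) ^ 2 * (c₀ * (eta F n K)⁻¹ ^ 3 * ∑ Y : Site (F.P K) (K - n), ∑ j : Fin 2, ∑ k : Fin 2, ‖c Y j k‖ ^ 2)) := by
  classical
  have hk : K - n ≤ (F.P K).m + (F.P K).K := by show K - n ≤ F.m + K; omega
  have hd : (F.P K).d = 3 := T3Family.P_d F K
  have hc : 0 < c₀ := Fact.out
  have hη : 0 < eta F n K := eta_pos F n K
  have hLη : (((F.P K).L : ℝ) ^ (F.P K).d) ^ (K - n) = (eta F n K)⁻¹ ^ 3 := by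
    rw [hd, show ((F.P K).L : ℝ) = (F.L : ℝ) from rfl, ← pow_mul, mul_comm, pow_mul]
    congr 1
    show (F.L : ℝ) ^ (K - n) = (((F.L : ℝ)⁻¹) ^ (K - n))⁻¹
    rw [inv_pow, inv_inv]
  -- the background is `U1`-valued
  have hU : ∀ b, bgUnits F K U₀ b ∈ U1 (Matrix (Fin 2) (Fin 2) ℂ) := by
    intro b
    have hval : ((bgUnits F K U₀ b : (Matrix (Fin 2) (Fin 2) ℂ)ˣ) : Matrix (Fin 2) (Fin 2) ℂ) = ((U₀ b : Matrix.specialUnitaryGroup (Fin 2) ℂ) : Matrix (Fin 2) (Fin 2) ℂ) := rfl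
    have hinv : (((bgUnits F K U₀ b)⁻¹ : (Matrix (Fin 2) (Fin 2) ℂ)ˣ) : Matrix (Fin 2) (Fin 2) ℂ) = star (((U₀ b : Matrix.specialUnitaryGroup (Fin 2) ℂ) : Matrix (Fin 2) (Fin 2) ℂ)) := by
      rw [← hval]; exact Prop7CovariantCoercivity.coe_inv_eq_star (toUField U₀ b).2
    rw [mem_U1, hval, hinv, norm_star]
    have h1 : ‖((U₀ b : Matrix.specialUnitaryGroup (Fin 2) ℂ) : Matrix (Fin 2) (Fin 2) ℂ)‖ = 1 := CStarRing.norm_of_mem_unitary (toUField U₀ b).2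
    exact ⟨h1.le, h1.le⟩
  -- the frames
  have hfrU : ∀ (Y : Site (F.P K) (K - n)) (x : Site (F.P K) 0), ((axialT (bgUnits F K U₀) (q Y) (embIter (K - n) Y))⁻¹ * axialT (bgUnits F K U₀) (q Y) x)⁻¹ ∈ U1 (Matrix (Fin 2) (Fin 2) ℂ) := by
    intro Y x
    have hw : ∀ z, axialT (bgUnits F K U₀) (q Y) z ∈ U1 (Matrix (Fin 2) (Fin 2) ℂ) := fun z => Prop7SymAvgTwSym.holT_mem_U1 hU _ _
    exact (U1 _).inv_mem ((U1 _).mul_mem ((U1 _).inv_mem (hw _)) (hw _))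
  -- the map
  let Sf : (Site (F.P K) (K - n) → Matrix (Fin 2) (Fin 2) ℂ) → (Site (F.P K) 0 → Matrix (Fin 2) (Fin 2) ℂ) := fun c x =>
    (χ (iterBlockOf (K - n) x) x) • conjR ((axialT (bgUnits F K U₀) (q (iterBlockOf (K - n) x)) (embIter (K - n) (iterBlockOf (K - n) x)))⁻¹ * axialT (bgUnits F K U₀) (q (iterBlockOf (K - n) x)) x)⁻¹ (c (iterBlockOf (K - n) x))
  have hadd : ∀ c₁ c₂, Sf (c₁ + c₂) = Sf c₁ + Sf c₂ := by
    intro c₁ c₂; funext x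
    simp only [Sf, Pi.add_apply, conjR_apply, mul_add, add_mul, smul_add]
  have hsmul : ∀ (a : ℂ) c, Sf (a • c) = a • Sf c := by
    intro a c; funext x
    simp only [Sf, Pi.smul_apply, conjR_apply, Matrix.mul_smul, Matrix.smul_mul]
    rw [smul_comm]
  let S : (Site (F.P K) (K - n) → Matrix (Fin 2) (Fin 2) ℂ) →ₗ[ℂ] (Site (F.P K) 0 → Matrix (Fin 2) (Fin 2) ℂ) :=
    { toFun := Sf, map_add' := hadd, map_smul' := hsmul }
  have hSx : ∀ c x, S c x = (χ (iterBlockOf (K - n) x) x) •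
      conjR ((axialT (bgUnits F K U₀) (q (iterBlockOf (K - n) x)) (embIter (K - n) (iterBlockOf (K - n) x)))⁻¹ * axialT (bgUnits F K U₀) (q (iterBlockOf (K - n) x)) x)⁻¹ (c (iterBlockOf (K - n) x)) := fun _ _ => rfl
  -- pointwise size `‖S c x‖ ≤ ‖c(Y x)‖`
  have hpt0 : ∀ c x, ‖S c x‖ ≤ ‖c (iterBlockOf (K - n) x)‖ := by
    intro c x
    rw [hSx, norm_smul, norm_conjR (hfrU _ _), Real.norm_eq_abs, abs_of_nonneg (hχ01 _ _).1]
    exact mul_le_of_le_one_left (norm_nonneg _) (hχ01 _ _).2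
  -- the common right-hand side
  have hQ : ∀ c : Site (F.P K) (K - n) → Matrix (Fin 2) (Fin 2) ℂ,
      c₀ * ((((F.P K).L : ℝ) ^ (F.P K).d) ^ (K - n) * ∑ Y : Site (F.P K) (K - n), ‖c Y‖ ^ 2)
        ≤ c₀ * (eta F n K)⁻¹ ^ 3 * ∑ Y : Site (F.P K) (K - n), ∑ j : Fin 2, ∑ l : Fin 2, ‖c Y j l‖ ^ 2 := by
    intro c
    rw [hLη, mul_assoc]
    refine mul_le_mul_of_nonneg_left (mul_le_mul_of_nonneg_left (Finset.sum_le_sum fun Y _ => MatrixNorms.opNorm_sq_le_sum_norm_sq (c Y)) (by positivity)) hc.le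
  refine ⟨S, hSx, fun c => ?_, fun c => ?_⟩
  · -- (H⁰)
    calc ‖toL2S F K c₀ (S c)‖ ^ 2 ≤ 2 * c₀ * ∑ x : Site (F.P K) 0, ‖S c x‖ ^ 2 := normSq_toL2S_le_two_mul F (S c)
      _ ≤ 2 * c₀ * ∑ x : Site (F.P K) 0, ‖c (iterBlockOf (K - n) x)‖ ^ 2 :=
          mul_le_mul_of_nonneg_left (Finset.sum_le_sum fun x _ => pow_le_pow_left₀ (norm_nonneg _) (hpt0 c x) 2) (by positivity)
      _ = 2 * (c₀ * ((((F.P K).L : ℝ) ^ (F.P K).d) ^ (K - n) * ∑ Y : Site (F.P K) (K - n), ‖c Y‖ ^ 2)) := by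
          rw [sum_comp_iterBlockOf hk (fun Y => ‖c Y‖ ^ 2)]; ring
      _ ≤ 2 * (c₀ * (eta F n K)⁻¹ ^ 3 * ∑ Y : Site (F.P K) (K - n), ∑ j : Fin 2, ∑ l : Fin 2, ‖c Y j l‖ ^ 2) :=
          mul_le_mul_of_nonneg_left (hQ c) (by norm_num)
  · -- (H¹)
    set G : PBond (F.P K) 0 → Matrix (Fin 2) (Fin 2) ℂ := (toL2 F K c₀).symm (DL2 F n K c₀ U₀ (toL2S F K c₀ (S c))) with hGdef
    have hback : DL2 F n K c₀ U₀ (toL2S F K c₀ (S c)) = toL2 F K c₀ G := by rw [hGdef, LinearEquiv.apply_symm_apply]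
    have hG : ∀ b, G b = (((eta F n K : ℝ) : ℂ)⁻¹) • (conjR (bgUnits F K U₀ b) (S c b.tgt) - S c b.src) := by
      intro b
      have hinv : ((((bgOfCfg F K U₀ (bondEquiv F K b))⁻¹ : (Matrix (Fin 2) (Fin 2) ℂ)ˣ) : Matrix (Fin 2) (Fin 2) ℂ)) =
          star (((U₀ b : Matrix.specialUnitaryGroup (Fin 2) ℂ) : Matrix (Fin 2) (Fin 2) ℂ)) := by
        rw [isUnitaryBg_bgOfCfg, val_bgOfCfg, Equiv.symm_apply_apply]
      rw [hGdef, DL2_apply, hinv, ← conjR_unitsField_toUField]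
      rfl
    -- pointwise bound on the stencil
    have hst : ∀ b : PBond (F.P K) 0, ‖conjR (bgUnits F K U₀ b) (S c b.tgt) - S c b.src‖ ≤ (2 * s₀ + lχ) * ‖c (iterBlockOf (K - n) b.src)‖ := by
      intro b
      by_cases h0 : χ (iterBlockOf (K - n) b.src) b.src = 0 ∧ χ (iterBlockOf (K - n) b.tgt) b.tgt = 0
      · rw [hSx, hSx, h0.1, h0.2, zero_smul, zero_smul, sub_zero]
        rw [show conjR (bgUnits F K U₀ b) (0 : Matrix (Fin 2) (Fin 2) ℂ) = 0 by rw [conjR_apply, mul_zero, zero_mul], norm_zero]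
        positivity
      · have hY : iterBlockOf (K - n) b.tgt = iterBlockOf (K - n) b.src := by
          rcases not_and_or.mp h0 with h | h
          · exact hχsh _ _ b.dir h
          · have h1 := hχun _ _ b.dir h
            have h2 : b.tgt.unshift b.dir = b.src := B10StarCount.unshift_shift b.src b.dir
            rw [h2] at h1
            exact h1.symm
        rw [hSx, hSx, hY]
        exact norm_conjR_framed_sub_framed_le (bgUnits F K U₀) hU (q (iterBlockOf (K - n) b.src)) (iterBlockOf (K - n) b.src) b (c (iterBlockOf (K - n) b.src))
          (hχ01 _ _).1 (hχ01 _ _).2 (hχlip _ _ b.dir) (hax _ b rfl hY)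
    have hpt : ∀ b : PBond (F.P K) 0, ‖G b‖ ^ 2 ≤ ((eta F n K)⁻¹ * (2 * s₀ + lχ)) ^ 2 * ‖c (iterBlockOf (K - n) b.src)‖ ^ 2 := by
      intro b
      rw [hG, norm_smul, norm_inv, Complex.norm_real, Real.norm_of_nonneg hη.le, ← mul_pow]
      refine pow_le_pow_left₀ (by positivity) ?_ 2
      rw [mul_assoc]
      exact mul_le_mul_of_nonneg_left (hst b) (by positivity)
    rw [hback, normSq_toL2_eq]
    have hsum : ∑ b : PBond (F.P K) 0, ‖c (iterBlockOf (K - n) b.src)‖ ^ 2 = 3 * ((((F.P K).L : ℝ) ^ (F.P K).d) ^ (K - n) * ∑ Y : Site (F.P K) (K - n), ‖c Y‖ ^ 2) := by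
      rw [sum_pbond_eq (fun b : PBond (F.P K) 0 => ‖c (iterBlockOf (K - n) b.src)‖ ^ 2)]
      simp only [Finset.sum_const, Finset.card_univ, Fintype.card_fin, hd, nsmul_eq_mul]
      rw [← Finset.mul_sum, sum_comp_iterBlockOf hk (fun Y => ‖c Y‖ ^ 2), hd]
      push_cast; ring
    calc c₀ * ∑ b : PBond (F.P K) 0, ∑ j : Fin 2, ∑ l : Fin 2, ‖G b j l‖ ^ 2
        ≤ c₀ * ∑ b : PBond (F.P K) 0, 2 * (((eta F n K)⁻¹ * (2 * s₀ + lχ)) ^ 2 * ‖c (iterBlockOf (K - n) b.src)‖ ^ 2) := by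
          refine mul_le_mul_of_nonneg_left (Finset.sum_le_sum fun b _ => ?_) hc.le
          have h1 := sum_norm_sq_le_mul_opNorm_sq (N := 2) (G b)
          have h2 := hpt b
          push_cast at h1
          linarith
      _ = 6 * ((2 * s₀ + lχ) / eta F n K) ^ 2 * (c₀ * ((((F.P K).L : ℝ) ^ (F.P K).d) ^ (K - n) * ∑ Y : Site (F.P K) (K - n), ‖c Y‖ ^ 2)) := by
          rw [← Finset.mul_sum, ← Finset.mul_sum, hsum, div_eq_inv_mul]; ring
      _ ≤ 6 * ((2 * s₀ + lχ) / eta F n K) ^ 2 * (c₀ * (eta F n K)⁻¹ ^ 3 * ∑ Y : Site (F.P K) (K - n), ∑ j : Fin 2, ∑ l : Fin 2, ‖c Y j l‖ ^ 2) :=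
          mul_le_mul_of_nonneg_left (hQ c) (by positivity)

end Member

/-! ## §4 (v1.1) The coarse currency read in the member-`n` Hilbert letters: the rows in `‖toL2S F n c₁ ·‖`-form for the (P2)-knit at (Y1) -/

section Y1

open Literature.MathematicalPhysics.QuantumFieldTheory.Balaban1983to89.T3ContinuumYM3Torus
open T3LevelShift (siteShift)
open T3PrintedRegularOrbits (sites_eq)
open T3SectALandauChart (eta eta_pos bgUnits)
open B7Eq78Linearization (conjR)
open B10Eq27TorusAxialLog (axialT gaugeActT)
open Summit.QuantumFields.YangMills.Theorems.Prop7SectET3HilbertLetters (toL2S DL2)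
open Summit.QuantumFields.YangMills.Theorems.Prop7NestedMeanPoincare (normSq_toL2S_eq)

variable (F : T3Family) {n K : ℕ} (h : n ≤ K)

/-- **THE COARSE CURRENCY IS THE MEMBER-`n` `L²` NORM OF THE TRANSPORTED FIELD**: `‖toL2S F n c₁ (c ∘ siteShift)‖² = c₁·Σ_Y Σ_{jk}|c(Y)_{jk}|²` (✓`normSq_toL2S_eq` at the member `n` + the
site identification ✓`T3LevelShift.siteShift (sites_eq F n K h) : Site (F.P n) 0 ≃ Site (F.P K) (K − n)`); so `Q c = ‖toL2S F n (c₀η⁻³) (c ∘ siteShift)‖²`, and the gauge `q` of the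
solve door ✓`Prop7RightInverseOfApprox.exists_rightInverse_of_approx_gauge` may be taken as this norm on the plain coarse fields. [cite: Balaban1985BackgroundPropagators, (3.11) p.392, (3.16) p.393] -/
theorem normSq_toL2S_comp_siteShift_eq {c₁ : ℝ} [Fact (0 < c₁)] (c : Site (F.P K) (K - n) → Matrix (Fin 2) (Fin 2) ℂ) :
    ‖toL2S F n c₁ (fun y => c (siteShift (sites_eq F n K h) y))‖ ^ 2 = c₁ * ∑ Y : Site (F.P K) (K - n), ∑ j : Fin 2, ∑ k : Fin 2, ‖c Y j k‖ ^ 2 := by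
  rw [normSq_toL2S_eq]
  congr 1
  exact Fintype.sum_equiv (siteShift (sites_eq F n K h)) _ _ fun _ => rfl

/-- ★★★ **THE ROWS OF THE BLOCK BUMP EXTENSION IN THE (P2)-KNIT'S CURRENCY** — ✓`exists_blockBumpExtension` with its two rows read through `normSq_toL2S_comp_siteShift_eq` at
`c₁ = c₀η⁻³`: `‖toL2S F K c₀ (S c)‖ ≤ √2·‖toL2S F n c₁ (c ∘ siteShift)‖` and `‖D_{U₀}(toL2S F K c₀ (S c))‖ ≤ (√6·(2s₀ + lχ)∕η)·‖toL2S F n c₁ (c ∘ siteShift)‖` — the `hS0`∕`hS1` slots of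
✓`Prop7ResolventSmoothing.hQ4_of_rows` with `q c := ‖toL2S F n c₁ (c ∘ siteShift)‖`, `s₀ := √2`, `s₁ := √6(2s₀ + lχ)∕η`. [cite: Balaban1985BackgroundPropagators, (3.3) p.391, (3.11) p.392, (3.114)-(3.115) p.418; Balaban1985RegularSpaces, Lemma 1 (1.25) p.79] -/
theorem exists_blockBumpExtension_rows {c₀ c₁ : ℝ} [Fact (0 < c₀)] [Fact (0 < c₁)] (hc₁ : c₁ = c₀ * (eta F n K)⁻¹ ^ 3)
    (U₀ : GaugeField (F.P K) 0 (Matrix.specialUnitaryGroup (Fin 2) ℂ))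
    (q : Site (F.P K) (K - n) → Site (F.P K) 0) (χ : Site (F.P K) (K - n) → Site (F.P K) 0 → ℝ) {s₀ lχ : ℝ} (hs₀ : 0 ≤ s₀) (hlχ : 0 ≤ lχ)
    (hχ01 : ∀ Y x, 0 ≤ χ Y x ∧ χ Y x ≤ 1)
    (hχsh : ∀ Y x μ, χ Y x ≠ 0 → iterBlockOf (K - n) (x.shift μ) = Y) (hχun : ∀ Y x μ, χ Y x ≠ 0 → iterBlockOf (K - n) (x.unshift μ) = Y)
    (hχlip : ∀ Y x μ, |χ Y (x.shift μ) - χ Y x| ≤ lχ)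
    (hax : ∀ (Y : Site (F.P K) (K - n)) (b : PBond (F.P K) 0), iterBlockOf (K - n) b.src = Y → iterBlockOf (K - n) b.tgt = Y →
      ‖((gaugeActT (axialT (bgUnits F K U₀) (q Y)) (bgUnits F K U₀) b : (Matrix (Fin 2) (Fin 2) ℂ)ˣ) : Matrix (Fin 2) (Fin 2) ℂ) - 1‖ ≤ s₀) :
    ∃ S : (Site (F.P K) (K - n) → Matrix (Fin 2) (Fin 2) ℂ) →ₗ[ℂ] (Site (F.P K) 0 → Matrix (Fin 2) (Fin 2) ℂ),
      (∀ c x, S c x = (χ (iterBlockOf (K - n) x) x) •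
        conjR ((axialT (bgUnits F K U₀) (q (iterBlockOf (K - n) x)) (embIter (K - n) (iterBlockOf (K - n) x)))⁻¹ *
          axialT (bgUnits F K U₀) (q (iterBlockOf (K - n) x)) x)⁻¹ (c (iterBlockOf (K - n) x))) ∧
      (∀ c, ‖toL2S F K c₀ (S c)‖ ≤ Real.sqrt 2 * ‖toL2S F n c₁ (fun y => c (siteShift (sites_eq F n K h) y))‖) ∧
      (∀ c, ‖DL2 F n K c₀ U₀ (toL2S F K c₀ (S c))‖ ≤
        (Real.sqrt 6 * ((2 * s₀ + lχ) / eta F n K)) * ‖toL2S F n c₁ (fun y => c (siteShift (sites_eq F n K h) y))‖) := by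
  obtain ⟨S, hS, h0, h1⟩ := exists_blockBumpExtension F (n := n) (K := K) (c₀ := c₀) U₀ q χ hs₀ hlχ hχ01 hχsh hχun hχlip hax
  have hη : 0 < eta F n K := eta_pos F n K
  have hQ : ∀ c : Site (F.P K) (K - n) → Matrix (Fin 2) (Fin 2) ℂ,
      c₀ * (eta F n K)⁻¹ ^ 3 * ∑ Y : Site (F.P K) (K - n), ∑ j : Fin 2, ∑ k : Fin 2, ‖c Y j k‖ ^ 2
        = ‖toL2S F n c₁ (fun y => c (siteShift (sites_eq F n K h) y))‖ ^ 2 := fun c => by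
    rw [normSq_toL2S_comp_siteShift_eq F h, hc₁]
  refine ⟨S, hS, fun c => ?_, fun c => ?_⟩
  · have h2 := h0 c
    rw [hQ c, ← Real.sqrt_le_sqrt_iff (by positivity)] at h2
    rwa [Real.sqrt_sq (norm_nonneg _), Real.sqrt_mul' _ (sq_nonneg _), Real.sqrt_sq (norm_nonneg _)] at h2
  · have h2 := h1 c
    have hA : 0 ≤ Real.sqrt 6 * ((2 * s₀ + lχ) / eta F n K) := by positivity
    rw [hQ c, ← Real.sqrt_le_sqrt_iff (by positivity)] at h2
    rw [Real.sqrt_sq (norm_nonneg _), Real.sqrt_mul' _ (sq_nonneg _), Real.sqrt_sq (norm_nonneg _), Real.sqrt_mul (by norm_num) ,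
      Real.sqrt_sq (by positivity)] at h2
    exact h2

end Y1

end Summit.QuantumFields.YangMills.Theorems.Prop7BlockBumpExtension

end
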